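import Summits.QuantumFields.YangMills.Theorems.BalabanUVNodesN07GuardedFamilyOfClassTop
import Summits.QuantumFields.YangMills.Theorems.BalabanUVNodesN07CentralResponseOnto
import Summits.QuantumFields.YangMills.Theorems.BalabanUVNodesN07Prop8StepFlatWitness
import HarnessLib

/-!
# BalabanUVNodes ∕ N07 — THE CHART ROAD FOR [15] PROPOSITION 8's CLASS ON THE SUPPORT OF RECORD: the per-level lifts, (45) at `U`, 35a's `IsFibreChartNear`,
# the (82) tangent form «curve-critical ⇒ tangent-critical» and the (141) current form, with `hCF`, the floor `(d+11)L ≤ M₁` and the `ε₀`∕`α` window the ONLY displayed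
# hypotheses — and the A6 certificate that this binder block is inhabited

Cell `pub-ymgap`, width seat `pub-ymgap-dag-n07-w2` generation 3 (HUMAN RULING D-0149; DAG node N07 = [15] = [Balaban1985Variational]; W-SEAT START LIST §n07, the w2 lane's
successor piece (a), file 2 = companion of `…N07GuardedFamilyOfClassTop`).  `--kind proof --supports stmt-QuantumFields-20542 --as helper` (K1⁷; count-neutral; theorems only).
CONSUMED BY NAME, nothing modified: `…N07GuardedFamilyOfClassTop.exists_guardedFamily_of_classTop_detSet` (the binders `S`, `hS`, `hα`, `h𝔹S` from the class), generation 2's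
`…N07CentralResponseOnto` §4 (`levelLifts_of_loopSmall`, `exists_velocity_preimage_of_loopSmall`, `isFibreChartNear_msChart_of_loopSmall`,
`hasDerivAt_wilsonAction4_expChart_of_isCritOnFibre_of_loopSmall`, `sum_re_trace_covDivT_eq_zero_of_isCritOnFibre_of_loopSmall`), dag-n21-c's top index
`K0TopIndexWrapGeometry.exists_seq_top`, dag-n07-e's flat-witness letters (`plaqSmallOn_one`, `wilsonAction4_one`, `isCritOnFibre_of_wilsonAction4_eq_zero`).

WHAT.  §1 the five consumers of the chart road re-keyed on [15] Proposition 8's hypotheses at the support of record — a separated (2.18) index `s` (`Sect2.SeqSeparated ν.M₁ s`)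
with `(d+11)L ≤ M₁`, `k` in the standing range, the (1.7) half of the class (6) ON THE TOP DOMAIN at radius `ε₀η_n²` for `n < k` (`ε₀` in [B7] Prop. 2's window charged by
`L²`), a guard radius `α` above `(((d+2)L)²∕4)(ε₀L² + 2C₀(d)(ε₀L²)²)` with `α ≤ 1∕24`, `α < δ_N`, `157α < L^{1−d}`, a level-bounded determining set `𝔹` whose pins sit over the
tower (`h𝔹Ω`: a bond of `bondsOf (𝔹 j)`, `1 ≤ j ≤ k`, has an end-point centre in `Ω_j` — met by the literal `genSet s.Ω k`, `…GuardedFamilyOfClassTop.bondsOf_genSet_subset_of_pins`,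
and by print's (2.3) family), 35j's chain-free towers `hCF`, `U` on the fibre of `W`: ★★ `levelLifts_of_classTop`, ★★ `exists_velocity_preimage_of_classTop` ((45) at `U`),
★★ `isFibreChartNear_msChart_of_classTop`, ★★★ `hasDerivAt_wilsonAction4_expChart_of_isCritOnFibre_of_classTop` ((82) on (83) for a curve-critical `U`),
★★ `sum_re_trace_covDivT_eq_zero_of_isCritOnFibre_of_classTop` ((141)).  §2 ★ `classTop_binders_inhabited_flat` (A6): for every `ν`, `M ≥ 1`, `g`, `K`, `k` the whole binder
block of §1 is inhabited at the EMPTY determining set by the flat datum and configuration on dag-n21-c's separated top index, with windows from `exists_windows`.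

READINGS (displayed, unchanged): `hCF` — for print's family [B6] (2.3) it is n07-e's 37a `chainFree_lamBond` once the fibre is keyed by it (ME #35, the (ii) re-key of
`bondsOf`∕`AgreeOn`); for the literal (b) family of a separated index with a proper domain it fails at the pins crossing `∂Ω_ℓ` (located reading, file 1's header) — hence the
abstract `𝔹`.  The floor `(d+11)L ≤ M₁` and the `ε₀`∕`α` window are letters a stub-1 closer chooses (`a₀`, `ν`).

HONEST FRAMING: composition of tree theorems; no estimate of [15] Sects. B–F asserted; stub 1 ∕ K0⁷ ∕ K1⁷ NOT closed; N07 NOT discharged; counts unmoved (5∕27); one finite T⁴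
programme at fixed ε — NOT continuum ∕ ℝ⁴ ∕ OS ∕ mass gap ∕ Clay: the Yang–Mills mass gap is NOT proved by any of this; R4 closes the conditional rung `BalabanLadder.UV` only.
No `sorry`, no `def`, no `instance`, no `notation`.

References: [15] T. Bałaban, CMP 102 (1985) 277–309 [Balaban1985Variational]; [6] CMP 99 (1985) 75–102 [Balaban1985RegularSpaces]; [B7] CMP 98 (1985) 17–51 [Balaban1985Averaging];
[I] CMP 109 (1987) 249–301 [Balaban1987RG1]; [III] CMP 119 (1988) 243–285 [Balaban1988Convergent]; [B6] CMP 96 (1984) 223–250 [Balaban1984PropagatorsII].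
-/

noncomputable section

open scoped Matrix.Norms.L2Operator Topology

namespace Summit.QuantumFields.YangMills.BalabanUVNodes.N07ChartRoadClassTop

open Literature.MathematicalPhysics.QuantumFieldTheory.Balaban1983to89
open Literature.MathematicalPhysics.QuantumFieldTheory.Balaban1983to89.T4Continuum (T4Family)
open Literature.MathematicalPhysics.QuantumFieldTheory.Balaban1983to89.B15DeterminingSets
open Literature.MathematicalPhysics.QuantumFieldTheory.Balaban1983to89.Node00
open Literature.MathematicalPhysics.QuantumFieldTheory.Balaban1983to89.BlockAveraging (Small Idx avgFun loopHol blockAvg)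
open Literature.MathematicalPhysics.QuantumFieldTheory.Balaban1983to89.ExpMeanLog (expMeanLogSU deltaSU)
open Literature.MathematicalPhysics.QuantumFieldTheory.Balaban1983to89.T4AdjointCovarianceUnitary (lieSU)
open Literature.MathematicalPhysics.QuantumFieldTheory.Balaban1983to89.BlockAveragingHaarAC (centralBond)
open Literature.MathematicalPhysics.QuantumFieldTheory.Balaban1983to89.B10Eq27TorusAxialLog (toUField unitsField)
open Literature.MathematicalPhysics.QuantumFieldTheory.Balaban1983to89.B10Eq68TorusRegularity (covDivT)
open Summit.QuantumFields.YangMills.BalabanUVNodes.N07CentralResponseOnto (levelLifts_of_loopSmall exists_velocity_preimage_of_loopSmall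
  isFibreChartNear_msChart_of_loopSmall hasDerivAt_wilsonAction4_expChart_of_isCritOnFibre_of_loopSmall sum_re_trace_covDivT_eq_zero_of_isCritOnFibre_of_loopSmall)
open Summit.QuantumFields.YangMills.BalabanUVNodes.N07GuardedFamilyOfClassTop (exists_guardedFamily_of_classTop_detSet exists_windows)
open Summit.QuantumFields.YangMills.Theorems.K0TopIndexWrapGeometry (exists_seq_top)
open Summit.QuantumFields.YangMills.BalabanUVNodes.N07AvoidanceAtFlatData (wilsonAction4_one)
open Summit.QuantumFields.YangMills.BalabanUVNodes.N07Prop8StepFlatWitness (plaqSmallOn_one)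

/-! ## §1  The chart road's consumers (`…CentralResponseOnto` §4) for [15] Proposition 8's class on the support of record -/

section Consumers

variable {F : T4Family} {N : ℕ} [NeZero N] {K k : ℕ}
variable {ν : Stage7Numerics} {M : ℕ} {g : ℕ → ℝ} {𝔹 : DetSet (F.P K)} {W : MSField (F.P K) (SU N)} {U : GaugeField (F.P K) 0 (SU N)}

/-- ★★ **THE PER-LEVEL LIFTS FOR THE TOP-DOMAIN CLASS** (`…CentralResponseOnto.levelLifts_of_loopSmall` with `S`, `hS`, `hα`, `h𝔹S` from §3): displayed `hCF`, the
floor `(d+11)L ≤ M₁`, the `ε₀`∕`α` window. [cite: Balaban1985Variational, (45) p.285, (83) p.290; Balaban1984PropagatorsII, p.228] -/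
theorem levelLifts_of_classTop (s : SeqOfRecord F ν M g K k)
    (hsep : Sect2.SeqSeparated ν.M₁ s) (hM₁ : ((F.P K).d + 11) * (F.P K).L ≤ ν.M₁) (hk : k ≤ (F.P K).m + (F.P K).K) {ε₀ α : ℝ} (hε₀ : 0 < ε₀)
    (hε3 : (143 * (((((F.P K).d + 4 : ℕ) : ℝ)) ^ 2 / 4) ^ 2) * (ε₀ * ((F.P K).L : ℝ) ^ 2) ≤ 1 / 3)
    (hε2 : 2 * (ε₀ * ((F.P K).L : ℝ) ^ 2) ≤ 2 * deltaSU (Fin N) / ((((F.P K).d + 4) * (F.P K).L : ℕ) : ℝ) ^ 2)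
    (hα : ((((F.P K).d + 2) * (F.P K).L : ℕ) : ℝ) ^ 2 / 4 *
        (ε₀ * ((F.P K).L : ℝ) ^ 2 + 2 * (143 * (((((F.P K).d + 4 : ℕ) : ℝ)) ^ 2 / 4) ^ 2) * (ε₀ * ((F.P K).L : ℝ) ^ 2) ^ 2) ≤ α)
    (hα24 : α ≤ 1 / 24) (hαδ : α < deltaSU (Fin N)) (hαL : 157 * α < (((F.P K).L : ℝ) ^ ((F.P K).d - 1))⁻¹)
    (h𝔹Ω : ∀ j, 1 ≤ j → j ≤ k → ∀ b ∈ bondsOf (𝔹 j), embIter j b.src ∈ s.Ω j ∨ embIter j b.tgt ∈ s.Ω j)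
    (hCF : ∀ ℓ, ℓ ≤ k → ∃ T : (i : ℕ) → Set (PBond (F.P K) i), bondsOf (𝔹 ℓ) ⊆ T ℓ ∧
      (∀ i, i < ℓ → ∀ c : PBond (F.P K) (i + 1), c ∈ T (i + 1) → centralBond c ∈ T i) ∧ ∀ j, j < ℓ → Disjoint (T j) (bondsOf (𝔹 j)))
    (h17 : ∀ n, n < k → PlaqSmallOn (Sect2.omegaPlaqsTop s.Ω (suppDomOfRecord F ν K s.Ω) n) (ε₀ * (F.P K).eta n ^ 2) U)
    (hU : AgreeOn 𝔹 (avgFamily (avOfRecord F N K) U) W) :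
    ∀ j, j ≤ k → ∀ σ : PBond (F.P K) j → lieSU (Fin N), ∃ X : PBond (F.P K) 0 → lieSU (Fin N),
      (∀ c ∈ bondsOf (𝔹 j), HasDerivAt (fun t : ℝ => ((avgFamily (avOfRecord F N K) (expChart U (t • X)) j c : SU N) : Matrix (Fin N) (Fin N) ℂ))
        (((W j c : SU N) : Matrix (Fin N) (Fin N) ℂ) * ((σ c : lieSU (Fin N)) : Matrix (Fin N) (Fin N) ℂ)) 0) ∧
      (∀ i, i < j → ∀ c ∈ bondsOf (𝔹 i), HasDerivAt (fun t : ℝ => ((avgFamily (avOfRecord F N K) (expChart U (t • X)) i c : SU N) : Matrix (Fin N) (Fin N) ℂ)) 0 0) := by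
  obtain ⟨S, hS, hαS, h𝔹S⟩ := exists_guardedFamily_of_classTop_detSet s hsep hM₁ hk hε₀ hε3 hε2 hα h𝔹Ω h17
  exact levelLifts_of_loopSmall hk hU S hS hαS hα24 hαδ hαL h𝔹S hCF

/-- ★★ **(45) AT `U` FOR THE TOP-DOMAIN CLASS** (a right inverse of the linearised multi-scale constraint, velocity currency).
[cite: Balaban1985Variational, (45) p.285, (83) p.290; Balaban1984PropagatorsII, p.228] -/
theorem exists_velocity_preimage_of_classTop (s : SeqOfRecord F ν M g K k)
    (hsep : Sect2.SeqSeparated ν.M₁ s) (hM₁ : ((F.P K).d + 11) * (F.P K).L ≤ ν.M₁) (hk : k ≤ (F.P K).m + (F.P K).K) {ε₀ α : ℝ} (hε₀ : 0 < ε₀)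
    (hε3 : (143 * (((((F.P K).d + 4 : ℕ) : ℝ)) ^ 2 / 4) ^ 2) * (ε₀ * ((F.P K).L : ℝ) ^ 2) ≤ 1 / 3)
    (hε2 : 2 * (ε₀ * ((F.P K).L : ℝ) ^ 2) ≤ 2 * deltaSU (Fin N) / ((((F.P K).d + 4) * (F.P K).L : ℕ) : ℝ) ^ 2)
    (hα : ((((F.P K).d + 2) * (F.P K).L : ℕ) : ℝ) ^ 2 / 4 *
        (ε₀ * ((F.P K).L : ℝ) ^ 2 + 2 * (143 * (((((F.P K).d + 4 : ℕ) : ℝ)) ^ 2 / 4) ^ 2) * (ε₀ * ((F.P K).L : ℝ) ^ 2) ^ 2) ≤ α)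
    (hα24 : α ≤ 1 / 24) (hαδ : α < deltaSU (Fin N)) (hαL : 157 * α < (((F.P K).L : ℝ) ^ ((F.P K).d - 1))⁻¹)
    (h𝔹Ω : ∀ j, 1 ≤ j → j ≤ k → ∀ b ∈ bondsOf (𝔹 j), embIter j b.src ∈ s.Ω j ∨ embIter j b.tgt ∈ s.Ω j)
    (hCF : ∀ ℓ, ℓ ≤ k → ∃ T : (i : ℕ) → Set (PBond (F.P K) i), bondsOf (𝔹 ℓ) ⊆ T ℓ ∧
      (∀ i, i < ℓ → ∀ c : PBond (F.P K) (i + 1), c ∈ T (i + 1) → centralBond c ∈ T i) ∧ ∀ j, j < ℓ → Disjoint (T j) (bondsOf (𝔹 j)))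
    (h17 : ∀ n, n < k → PlaqSmallOn (Sect2.omegaPlaqsTop s.Ω (suppDomOfRecord F ν K s.Ω) n) (ε₀ * (F.P K).eta n ^ 2) U)
    (hU : AgreeOn 𝔹 (avgFamily (avOfRecord F N K) U) W) (τ : (j : ℕ) → PBond (F.P K) j → lieSU (Fin N)) :
    ∃ X : PBond (F.P K) 0 → lieSU (Fin N), ∀ j, j ≤ k → ∀ c ∈ bondsOf (𝔹 j),
      HasDerivAt (fun t : ℝ => ((avgFamily (avOfRecord F N K) (expChart U (t • X)) j c : SU N) : Matrix (Fin N) (Fin N) ℂ))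
        (((W j c : SU N) : Matrix (Fin N) (Fin N) ℂ) * ((τ j c : lieSU (Fin N)) : Matrix (Fin N) (Fin N) ℂ)) 0 := by
  obtain ⟨S, hS, hαS, h𝔹S⟩ := exists_guardedFamily_of_classTop_detSet s hsep hM₁ hk hε₀ hε3 hε2 hα h𝔹Ω h17
  exact exists_velocity_preimage_of_loopSmall hk hU S hS hαS hα24 hαδ hαL h𝔹S hCF τ

/-- ★★ **35a's `IsFibreChartNear` FOR THE CANONICAL MULTI-SCALE CHART, TOP-DOMAIN CLASS.**
[cite: Balaban1985Variational, (45)–(48) p.285, Prop. 3 p.289, (82)–(83) p.290; Balaban1988Convergent, (2.10)–(2.12) p.256] -/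
theorem isFibreChartNear_msChart_of_classTop (s : SeqOfRecord F ν M g K k)
    (hsep : Sect2.SeqSeparated ν.M₁ s) (hM₁ : ((F.P K).d + 11) * (F.P K).L ≤ ν.M₁) (hk : k ≤ (F.P K).m + (F.P K).K) {ε₀ α : ℝ} (hε₀ : 0 < ε₀)
    (hε3 : (143 * (((((F.P K).d + 4 : ℕ) : ℝ)) ^ 2 / 4) ^ 2) * (ε₀ * ((F.P K).L : ℝ) ^ 2) ≤ 1 / 3)
    (hε2 : 2 * (ε₀ * ((F.P K).L : ℝ) ^ 2) ≤ 2 * deltaSU (Fin N) / ((((F.P K).d + 4) * (F.P K).L : ℕ) : ℝ) ^ 2)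
    (hα : ((((F.P K).d + 2) * (F.P K).L : ℕ) : ℝ) ^ 2 / 4 *
        (ε₀ * ((F.P K).L : ℝ) ^ 2 + 2 * (143 * (((((F.P K).d + 4 : ℕ) : ℝ)) ^ 2 / 4) ^ 2) * (ε₀ * ((F.P K).L : ℝ) ^ 2) ^ 2) ≤ α)
    (hα24 : α ≤ 1 / 24) (hαδ : α < deltaSU (Fin N)) (hαL : 157 * α < (((F.P K).L : ℝ) ^ ((F.P K).d - 1))⁻¹)
    (h𝔹 : ∀ j, k < j → 𝔹 j = ∅)
    (h𝔹Ω : ∀ j, 1 ≤ j → j ≤ k → ∀ b ∈ bondsOf (𝔹 j), embIter j b.src ∈ s.Ω j ∨ embIter j b.tgt ∈ s.Ω j)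
    (hCF : ∀ ℓ, ℓ ≤ k → ∃ T : (i : ℕ) → Set (PBond (F.P K) i), bondsOf (𝔹 ℓ) ⊆ T ℓ ∧
      (∀ i, i < ℓ → ∀ c : PBond (F.P K) (i + 1), c ∈ T (i + 1) → centralBond c ∈ T i) ∧ ∀ j, j < ℓ → Disjoint (T j) (bondsOf (𝔹 j)))
    (h17 : ∀ n, n < k → PlaqSmallOn (Sect2.omegaPlaqsTop s.Ω (suppDomOfRecord F ν K s.Ω) n) (ε₀ * (F.P K).eta n ^ 2) U)
    (hU : AgreeOn 𝔹 (avgFamily (avOfRecord F N K) U) W) :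
    IsFibreChartNear F N K 𝔹 W U (msChart F N K k 𝔹 W U) (fderiv ℝ (msChart F N K k 𝔹 W U) 0) := by
  obtain ⟨S, hS, hαS, h𝔹S⟩ := exists_guardedFamily_of_classTop_detSet s hsep hM₁ hk hε₀ hε3 hε2 hα h𝔹Ω h17
  exact isFibreChartNear_msChart_of_loopSmall h𝔹 hk hU S hS hαS hα24 hαδ hαL h𝔹S hCF

/-- ★★★ **CURVE-CRITICAL ⇒ TANGENT-CRITICAL FOR [15] PROPOSITION 8's CLASS ON THE SUPPORT OF RECORD.**  A separated (2.18) index with `(d+11)L ≤ M₁`, `k` in the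
standing range, a level-bounded determining set `𝔹` with pins over the tower and chain-free towers (`hCF`), `U` with (1.7) on the top domain at radius `ε₀η_n²` for
`n < k` (`ε₀` in the window, guard radius `α ≤ 1∕24`, `α < δ_N`, `157α < L^{1−d}`), `U` on the fibre of `W` and curve-critical for (5) there ⇒ `d∕dt A(U·exp(tX))|₀ = 0`
for every joint-kernel direction `X` — print's (82) on (83), with NO whole-torus guard. [cite: Balaban1985Variational, (2),(6) p.278, (82)–(83) p.290, (141) p.299, Prop. 8 p.304, (45) p.285; Balaban1987RG1, (0.4) p.253; Balaban1985Averaging, Prop. 2 (52)–(54) p.26] -/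
theorem hasDerivAt_wilsonAction4_expChart_of_isCritOnFibre_of_classTop (s : SeqOfRecord F ν M g K k)
    (hsep : Sect2.SeqSeparated ν.M₁ s) (hM₁ : ((F.P K).d + 11) * (F.P K).L ≤ ν.M₁) (hk : k ≤ (F.P K).m + (F.P K).K) {ε₀ α : ℝ} (hε₀ : 0 < ε₀)
    (hε3 : (143 * (((((F.P K).d + 4 : ℕ) : ℝ)) ^ 2 / 4) ^ 2) * (ε₀ * ((F.P K).L : ℝ) ^ 2) ≤ 1 / 3)
    (hε2 : 2 * (ε₀ * ((F.P K).L : ℝ) ^ 2) ≤ 2 * deltaSU (Fin N) / ((((F.P K).d + 4) * (F.P K).L : ℕ) : ℝ) ^ 2)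
    (hα : ((((F.P K).d + 2) * (F.P K).L : ℕ) : ℝ) ^ 2 / 4 *
        (ε₀ * ((F.P K).L : ℝ) ^ 2 + 2 * (143 * (((((F.P K).d + 4 : ℕ) : ℝ)) ^ 2 / 4) ^ 2) * (ε₀ * ((F.P K).L : ℝ) ^ 2) ^ 2) ≤ α)
    (hα24 : α ≤ 1 / 24) (hαδ : α < deltaSU (Fin N)) (hαL : 157 * α < (((F.P K).L : ℝ) ^ ((F.P K).d - 1))⁻¹)
    (h𝔹 : ∀ j, k < j → 𝔹 j = ∅)
    (h𝔹Ω : ∀ j, 1 ≤ j → j ≤ k → ∀ b ∈ bondsOf (𝔹 j), embIter j b.src ∈ s.Ω j ∨ embIter j b.tgt ∈ s.Ω j)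
    (hCF : ∀ ℓ, ℓ ≤ k → ∃ T : (i : ℕ) → Set (PBond (F.P K) i), bondsOf (𝔹 ℓ) ⊆ T ℓ ∧
      (∀ i, i < ℓ → ∀ c : PBond (F.P K) (i + 1), c ∈ T (i + 1) → centralBond c ∈ T i) ∧ ∀ j, j < ℓ → Disjoint (T j) (bondsOf (𝔹 j)))
    (h17 : ∀ n, n < k → PlaqSmallOn (Sect2.omegaPlaqsTop s.Ω (suppDomOfRecord F ν K s.Ω) n) (ε₀ * (F.P K).eta n ^ 2) U)
    (hU : AgreeOn 𝔹 (avgFamily (avOfRecord F N K) U) W) (hcrit : IsCritOnFibre F N K 𝔹 W U) {X : PBond (F.P K) 0 → lieSU (Fin N)}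
    (hX : ∀ j, j ≤ k → ∀ c ∈ bondsOf (𝔹 j),
      HasDerivAt (fun t : ℝ => ((avgFamily (avOfRecord F N K) (expChart U (t • X)) j c : SU N) : Matrix (Fin N) (Fin N) ℂ)) 0 0) :
    HasDerivAt (fun t : ℝ => wilsonAction4 (expChart U (t • X))) 0 0 := by
  obtain ⟨S, hS, hαS, h𝔹S⟩ := exists_guardedFamily_of_classTop_detSet s hsep hM₁ hk hε₀ hε3 hε2 hα h𝔹Ω h17
  exact hasDerivAt_wilsonAction4_expChart_of_isCritOnFibre_of_loopSmall h𝔹 hk hU S hS hαS hα24 hαδ hαL h𝔹S hCF hcrit hX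

/-- ★★ **THE (141) CURRENT FORM FOR [15] PROPOSITION 8's CLASS**: under the same hypotheses, `Σ_b Re Tr(U_bX_bU_b⋆ · η(D^{η*}_U∂U)(b)) = 0` for every joint-kernel
direction `X` (n07-e's 35g after the tangent form above). [cite: Balaban1985Variational, (2),(5) p.278, (141) p.299, p.300; Balaban1985RegularSpaces, (1.1)–(1.2) p.76] -/
theorem sum_re_trace_covDivT_eq_zero_of_isCritOnFibre_of_classTop (s : SeqOfRecord F ν M g K k)
    (hsep : Sect2.SeqSeparated ν.M₁ s) (hM₁ : ((F.P K).d + 11) * (F.P K).L ≤ ν.M₁) (hk : k ≤ (F.P K).m + (F.P K).K) {ε₀ α : ℝ} (hε₀ : 0 < ε₀)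
    (hε3 : (143 * (((((F.P K).d + 4 : ℕ) : ℝ)) ^ 2 / 4) ^ 2) * (ε₀ * ((F.P K).L : ℝ) ^ 2) ≤ 1 / 3)
    (hε2 : 2 * (ε₀ * ((F.P K).L : ℝ) ^ 2) ≤ 2 * deltaSU (Fin N) / ((((F.P K).d + 4) * (F.P K).L : ℕ) : ℝ) ^ 2)
    (hα : ((((F.P K).d + 2) * (F.P K).L : ℕ) : ℝ) ^ 2 / 4 *
        (ε₀ * ((F.P K).L : ℝ) ^ 2 + 2 * (143 * (((((F.P K).d + 4 : ℕ) : ℝ)) ^ 2 / 4) ^ 2) * (ε₀ * ((F.P K).L : ℝ) ^ 2) ^ 2) ≤ α)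
    (hα24 : α ≤ 1 / 24) (hαδ : α < deltaSU (Fin N)) (hαL : 157 * α < (((F.P K).L : ℝ) ^ ((F.P K).d - 1))⁻¹)
    (h𝔹 : ∀ j, k < j → 𝔹 j = ∅)
    (h𝔹Ω : ∀ j, 1 ≤ j → j ≤ k → ∀ b ∈ bondsOf (𝔹 j), embIter j b.src ∈ s.Ω j ∨ embIter j b.tgt ∈ s.Ω j)
    (hCF : ∀ ℓ, ℓ ≤ k → ∃ T : (i : ℕ) → Set (PBond (F.P K) i), bondsOf (𝔹 ℓ) ⊆ T ℓ ∧
      (∀ i, i < ℓ → ∀ c : PBond (F.P K) (i + 1), c ∈ T (i + 1) → centralBond c ∈ T i) ∧ ∀ j, j < ℓ → Disjoint (T j) (bondsOf (𝔹 j)))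
    (h17 : ∀ n, n < k → PlaqSmallOn (Sect2.omegaPlaqsTop s.Ω (suppDomOfRecord F ν K s.Ω) n) (ε₀ * (F.P K).eta n ^ 2) U)
    (hU : AgreeOn 𝔹 (avgFamily (avOfRecord F N K) U) W) (hcrit : IsCritOnFibre F N K 𝔹 W U) {X : PBond (F.P K) 0 → lieSU (Fin N)}
    (hX : ∀ j, j ≤ k → ∀ c ∈ bondsOf (𝔹 j),
      HasDerivAt (fun t : ℝ => ((avgFamily (avOfRecord F N K) (expChart U (t • X)) j c : SU N) : Matrix (Fin N) (Fin N) ℂ)) 0 0)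
    {η : ℝ} (hη : η ≠ 0) :
    ∑ b : PBond (F.P K) 0, (Matrix.trace (((U b : SU N) : Matrix (Fin N) (Fin N) ℂ) * (X b : Matrix (Fin N) (Fin N) ℂ) * star ((U b : SU N) : Matrix (Fin N) (Fin N) ℂ) *
      (η • covDivT η (unitsField (toUField U)) b.dir b.src))).re = 0 := by
  obtain ⟨S, hS, hαS, h𝔹S⟩ := exists_guardedFamily_of_classTop_detSet s hsep hM₁ hk hε₀ hε3 hε2 hα h𝔹Ω h17
  exact sum_re_trace_covDivT_eq_zero_of_isCritOnFibre_of_loopSmall h𝔹 hk hU S hS hαS hα24 hαδ hαL h𝔹S hCF hcrit hX hη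

end Consumers

/-! ## §2  Non-vacuity (A6): §1's whole binder block is inhabited (flat configuration, empty determining set) -/

section Flat

variable (F : T4Family) (N : ℕ) [NeZero N]

/-- **NON-VACUITY (A6) OF §1's BINDER BLOCK**: for every numerics `ν`, cube letter `M ≥ 1`, history `g`, depth `K`, step `k` there are a SEPARATED (2.18) index
(dag-n21-c's top index `exists_seq_top`), windows `ε₀`, `α` (`exists_windows`), a datum and a configuration (both flat) satisfying every hypothesis of §1 at the EMPTY
determining set: separation, the windows, (1.7) on the top domain at every scale, the fibre condition, curve-criticality (zero action), level-boundedness, pins over the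
tower and `hCF` (vacuous at `∅`).  The floor `(d+11)L ≤ M₁` and the standing range are letters of `ν`∕`k`. [cite: Balaban1985Variational, Prop. 8 p.304 (bookkeeping); Balaban1988Convergent, (2.18) p.257] -/
theorem classTop_binders_inhabited_flat (ν : Stage7Numerics) {M : ℕ} (hM : 1 ≤ M) (g : ℕ → ℝ) (K k : ℕ) :
    ∃ (s : SeqOfRecord F ν M g K k) (ε₀ α : ℝ) (W : MSField (F.P K) (SU N)) (U : GaugeField (F.P K) 0 (SU N)),
      Sect2.SeqSeparated ν.M₁ s ∧ 0 < ε₀ ∧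
      (143 * (((((F.P K).d + 4 : ℕ) : ℝ)) ^ 2 / 4) ^ 2) * (ε₀ * ((F.P K).L : ℝ) ^ 2) ≤ 1 / 3 ∧
      2 * (ε₀ * ((F.P K).L : ℝ) ^ 2) ≤ 2 * deltaSU (Fin N) / ((((F.P K).d + 4) * (F.P K).L : ℕ) : ℝ) ^ 2 ∧
      ((((F.P K).d + 2) * (F.P K).L : ℕ) : ℝ) ^ 2 / 4 *
          (ε₀ * ((F.P K).L : ℝ) ^ 2 + 2 * (143 * (((((F.P K).d + 4 : ℕ) : ℝ)) ^ 2 / 4) ^ 2) * (ε₀ * ((F.P K).L : ℝ) ^ 2) ^ 2) ≤ α ∧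
      α ≤ 1 / 24 ∧ α < deltaSU (Fin N) ∧ 157 * α < (((F.P K).L : ℝ) ^ ((F.P K).d - 1))⁻¹ ∧
      (∀ n, n < k → PlaqSmallOn (Sect2.omegaPlaqsTop s.Ω (suppDomOfRecord F ν K s.Ω) n) (ε₀ * (F.P K).eta n ^ 2) U) ∧
      AgreeOn (fun _ => ∅) (avgFamily (avOfRecord F N K) U) W ∧
      IsCritOnFibre F N K (fun _ => ∅) W U ∧
      (∀ j, 1 ≤ j → j ≤ k → ∀ b ∈ bondsOf (∅ : Set (Site (F.P K) j)), embIter j b.src ∈ s.Ω j ∨ embIter j b.tgt ∈ s.Ω j) ∧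
      (∀ ℓ, ℓ ≤ k → ∃ T : (i : ℕ) → Set (PBond (F.P K) i), bondsOf (∅ : Set (Site (F.P K) ℓ)) ⊆ T ℓ ∧
        (∀ i, i < ℓ → ∀ c : PBond (F.P K) (i + 1), c ∈ T (i + 1) → centralBond c ∈ T i) ∧
        ∀ j, j < ℓ → Disjoint (T j) (bondsOf (∅ : Set (Site (F.P K) j)))) := by
  obtain ⟨s, -, hsep⟩ := exists_seq_top F ν hM g K k
  obtain ⟨ε₀, α, hε₀, hε3, hε2, hα, hα24, hαδ, hαL⟩ := exists_windows (F.P K) N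
  have hη : ∀ n, 0 < (F.P K).eta n := fun n => by
    unfold Params.eta; exact pow_pos (inv_pos.mpr (Nat.cast_pos.mpr (F.P K).L_pos)) n
  have hbE : ∀ (j : ℕ) (b : PBond (F.P K) j), b ∉ bondsOf (∅ : Set (Site (F.P K) j)) := fun j b hb => by
    rcases hb with h | h <;> exact h
  refine ⟨s, ε₀, α, fun _ _ => 1, 1, hsep, hε₀, hε3, hε2, hα, hα24, hαδ, hαL,
    fun n _ => plaqSmallOn_one _ (mul_pos hε₀ (pow_pos (hη n) 2)), fun j b hb => (hbE j b hb).elim,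
    isCritOnFibre_of_wilsonAction4_eq_zero wilsonAction4_one, fun j _ _ b hb => (hbE j b hb).elim,
    fun ℓ _ => ⟨fun _ => ∅, fun b hb => (hbE ℓ b hb).elim, fun i _ c hc => hc.elim, fun j _ => ?_⟩⟩
  exact Set.disjoint_iff_inter_eq_empty.mpr (Set.empty_inter _)

end Flat

end Summit.QuantumFields.YangMills.BalabanUVNodes.N07ChartRoadClassTop

end
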